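import Summits.QuantumFields.YangMills.Theorems.FluctuationComparisonRegPrIntLWreg
import HarnessLib

/-!
# `FluctuationComparisonRegPrIntLVirialFlowDiff` — DIFF OF LINE g20-1 «VIRIAL FLOW FOR H4ᶜ»: THE λ-SCALED FLUCTUATION PART IS DIFFERENTIABLE IN λ ON THE WINDOW
# (crux `UnitScaleTilt.FluctuationComparisonRegPrIntL`, stmt-QuantumFields-20520; organ H4ᶜ `BeyondOneLoopSmallCan`; line file `Cruxes/…/Lines/virial_flow.lean`)

Cell `ym3-torus` (YM ladder rung R3 = continuum SU(2) Yang–Mills on T³ — a RUNG, NOT the Clay problem: not d = 4, not infinite volume, not a mass gap);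
width seat `ym3-torus-px19` (gen 11); helper `--supports stmt-QuantumFields-20520`.  THEOREMS ONLY (0 `def`, 0 `sorry`, default heartbeats).

WHAT.  LINE g20-1 (ideator ym-r3-idea-1 g20, «control» lens) reduces the organ H4ᶜ to DIFF ∧ FMIX, where **DIFF `FluctDifferentiableCan`** («S∕M, hand-ready
for the LAPLACE∕WREG pens») says: in the package regime, for every run `K`, height `J ≤ K`, window datum `V` and `λ ≥ 1`, the map
`μ ↦ f^μ(V) := log heightDensityCan F (γ∕μ) (histGood at θBal(γ)) V + β_K(γ∕μ)·minActionRegPr(V)` is differentiable at `λ`.  This file PROVES that text over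
the Theorems-side letters (✓`…WregGlue.heightDensityCan`, definitionally the line file's `heightDensityCan`; the line's `fluctAtCan` unfolded), so that the line
closes `stub_fluctDifferentiableCan := fluctDifferentiableCan` by `delta`:
* §1 `scheme_β_div_eq_mul_inv` — `β_K(γ∕μ) = μ·(γ·ε_K)⁻¹` (the inverse coupling is LINEAR in `μ`; cousin of ✓`…S2BetaLaplaceKnit.scheme_β_div`, not imported to keep
  this file on the WREG olean only);
* §2 ★`hasDerivAt_fibreInt` — for a window chart `c` (✓`…WregGlue.WindowChart`) the fibre integral `μ ↦ ∫ jac(V,z)·𝟙_S(Φ(V,z))·e^{−μβ₀A(Φ(V,z))} dν(z)` has a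
  derivative at every `μ₀ > 0` (dominated differentiation, `hasDerivAt_integral_of_dominated_loc_of_deriv_le`: the configuration space is compact, `0 ≤ A ≤ 2·#plaquettes`
  (✓`wilsonAction4_le_two_mul_card`), `jac ≤ bound`, the Haar product measure is finite);
* §3 ★★★`fluctDifferentiableCan` — DIFF's text: on the window the canonical version at weight coupling `γ∕μ` IS that fibre integral for EVERY `μ > 0`
  (✓`…WregGlue.heightDensityCan_eq_fibreInt` on the chart of ✓`…Wreg.windowCharts` — one chart, all couplings), it is positive there (✓`…Wreg.windowRegularity` (P) at
  `γ′ = γ∕λ`), so `log ∘` it is differentiable at `λ`; the second summand is linear in `μ`.  Thresholds: `pS := 0`, `ε₁ := 1`, `γ₁ := min γ₁^CHART γ₁^WREG`.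
The line card's caveat (i) («the package regime may pinch under the `b₀`-rescaling») does not arise: ✓`heightDensityCan_eq_fibreInt` holds for every weight
coupling `γ′ ≥ 0` on the FIXED `γ`-window chart, no rescaling of `b₀`.

HONEST SCOPE.  Dominated differentiation + the landed WREG table; DIFF is the S∕M row of the line — the organ FMIX (`FlowFourPtDecayCan`, XL), H4ᶜ, S2β, the crux
`FluctuationComparisonRegPrIntL` 20520 and the rung `YM3TorusSU2` are NOT proved; no summit statement is proved; the Yang–Mills mass gap is NOT proved.
References: [Balaban1985UV3] (2) p. 256 (the restricted densities), (41) p. 266; [Michael1987] (2.3) (coupling-constant differentiation of lattice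
free energies); [Balaban1987RG1] (0.13) p. 254 (fibre integrals of the averaging).
-/

noncomputable section

set_option autoImplicit false

open MeasureTheory Filter Topology Set Metric
open scoped ENNReal NNReal
open Literature.MathematicalPhysics.QuantumFieldTheory.Balaban1983to89
open Literature.MathematicalPhysics.QuantumFieldTheory.Balaban1983to89.T3ContinuumYM3Torus
open Literature.MathematicalPhysics.QuantumFieldTheory.Balaban1983to89.T3UnitLawDensityEML
open Literature.MathematicalPhysics.QuantumFieldTheory.Balaban1983to89.T3UnitScaleTilt
open Literature.MathematicalPhysics.QuantumFieldTheory.Balaban1983to89.T3PrintedRegularMinimiser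
open Literature.MathematicalPhysics.QuantumFieldTheory.Balaban1983to89.Missing
open Summit.QuantumFields.YangMills.Theorems.FluctuationComparisonRegPrIntLWregGlue
open Summit.QuantumFields.YangMills.Theorems.FluctuationComparisonRegPrIntLWreg (windowCharts windowRegularity)

namespace Summit.QuantumFields.YangMills.Theorems.FluctuationComparisonRegPrIntLVirialFlowDiff

/-! ## §1 The inverse coupling is linear in the deformation parameter -/

/-- `β_K(γ∕μ) = (γ∕μ·ε_K)⁻¹ = μ·(γ·ε_K)⁻¹` (cousin of ✓`…S2BetaLaplaceKnit.scheme_β_div`, which reads `= μ·β_K(γ)`). [cite: Balaban1985UV3, (1)-(3) p.256] -/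
theorem scheme_β_div_eq_mul_inv (F : T3Family) (γ μ : ℝ) (K : ℕ) :
    (F.scheme ℰp (γ / μ)).β K = μ * (γ * (F.P K).eps)⁻¹ := by
  show (γ / μ * (F.P K).eps)⁻¹ = μ * (γ * (F.P K).eps)⁻¹
  rw [div_mul_eq_mul_div, inv_div, div_eq_mul_inv]

/-! ## §2 Dominated differentiation of the chart fibre integral in the coupling -/

section FibreInt

variable {F : T3Family} {J K : ℕ} {hJK : J ≤ K} {Sfine : Set (GaugeField (F.P K) 0 (Matrix.specialUnitaryGroup (Fin 2) ℂ))}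
  {O : Set (GaugeField (F.P J) 0 (Matrix.specialUnitaryGroup (Fin 2) ℂ))}

/-- The `μ`-derivative of `𝟙_S(U)·e^{−μβ₀A(U)}` is `𝟙_S(U)·(−β₀A(U))·e^{−μβ₀A(U)}`. [folklore] -/
theorem hasDerivAt_indicator_boltzmann (U : GaugeField (F.P K) 0 (Matrix.specialUnitaryGroup (Fin 2) ℂ)) (β₀ μ : ℝ) :
    HasDerivAt (fun μ' : ℝ => Sfine.indicator (boltzmann (F.P K) (μ' * β₀)) U)
      (Sfine.indicator (fun U' => -(β₀ * wilsonAction4 U') * boltzmann (F.P K) (μ * β₀) U') U) μ := by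
  by_cases hU : U ∈ Sfine
  · simp only [Set.indicator_of_mem hU]
    unfold boltzmann
    have h : HasDerivAt (fun μ' : ℝ => -(μ' * β₀) * wilsonAction4 U) (-(1 * β₀) * wilsonAction4 U) μ :=
      ((hasDerivAt_id μ).mul_const β₀).neg.mul_const _
    have := h.exp
    simp only [one_mul] at this
    convert this using 1
    ring
  · simp only [Set.indicator_of_notMem hU]
    exact hasDerivAt_const μ 0

/-- ★ **THE CHART FIBRE INTEGRAL IS DIFFERENTIABLE IN THE COUPLING**: for a window chart `c`, measurable `S`, `β₀ ≥ 0` and `μ₀ > 0`,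
`μ ↦ ∫ jac(V,z)·𝟙_S(Φ(V,z))·e^{−μβ₀A(Φ(V,z))} dν(z)` has a derivative at `μ₀` (dominated differentiation on the compact configuration space: `0 ≤ A ≤ 2·#plaquettes`,
`jac ≤ bound`, finite Haar product measure). [cite: Michael1987, (2.3); Balaban1987RG1, (0.13) p.254] -/
theorem hasDerivAt_fibreInt (c : WindowChart F hJK Sfine O) (hSm : MeasurableSet Sfine) {β₀ : ℝ} (hβ₀ : 0 ≤ β₀)
    (V : GaugeField (F.P J) 0 (Matrix.specialUnitaryGroup (Fin 2) ℂ)) {μ₀ : ℝ} (hμ₀ : 0 < μ₀) :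
    HasDerivAt (fun μ : ℝ => ∫ z, (c.jac (V, z) : ℝ) * Sfine.indicator (boltzmann (F.P K) (μ * β₀)) (c.Φ (V, z))
        ∂fieldMeasure (F.P K) 0 (Matrix.specialUnitaryGroup (Fin 2) ℂ))
      (∫ z, (c.jac (V, z) : ℝ) * Sfine.indicator (fun U' => -(β₀ * wilsonAction4 U') * boltzmann (F.P K) (μ₀ * β₀) U') (c.Φ (V, z))
        ∂fieldMeasure (F.P K) 0 (Matrix.specialUnitaryGroup (Fin 2) ℂ)) μ₀ := by
  set ν := fieldMeasure (F.P K) 0 (Matrix.specialUnitaryGroup (Fin 2) ℂ) with hν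
  set Amax : ℝ := 2 * Fintype.card (Plaq (F.P K) 0) with hAmax
  have hA0 : ∀ U : GaugeField (F.P K) 0 (Matrix.specialUnitaryGroup (Fin 2) ℂ), 0 ≤ wilsonAction4 U := fun U => wilsonAction4_nonneg U
  have hAle : ∀ U : GaugeField (F.P K) 0 (Matrix.specialUnitaryGroup (Fin 2) ℂ), wilsonAction4 U ≤ Amax := fun U =>
    T3MinimiserStabilityReduction.wilsonAction4_le_two_mul_card U
  have hAm : Measurable fun U : GaugeField (F.P K) 0 (Matrix.specialUnitaryGroup (Fin 2) ℂ) => wilsonAction4 U :=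
    measurable_wilsonAction4 RegularGaugeGroup.measurable_reTr
  -- the integrand and its derivative
  set Fμ : ℝ → GaugeField (F.P K) 0 (Matrix.specialUnitaryGroup (Fin 2) ℂ) → ℝ :=
    fun μ z => (c.jac (V, z) : ℝ) * Sfine.indicator (boltzmann (F.P K) (μ * β₀)) (c.Φ (V, z)) with hFμ
  set F' : ℝ → GaugeField (F.P K) 0 (Matrix.specialUnitaryGroup (Fin 2) ℂ) → ℝ :=
    fun μ z => (c.jac (V, z) : ℝ) * Sfine.indicator (fun U' => -(β₀ * wilsonAction4 U') * boltzmann (F.P K) (μ * β₀) U') (c.Φ (V, z)) with hF'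
  have hjm : Measurable fun z => (c.jac (V, z) : ℝ) := measurable_coe_nnreal_real.comp (c.measurable_jac.comp measurable_prodMk_left)
  have hΦm : Measurable fun z => c.Φ (V, z) := c.measurable_Φ.comp measurable_prodMk_left
  have hFm : ∀ μ, AEStronglyMeasurable (Fμ μ) ν := fun μ =>
    (hjm.mul (((measurable_boltzmann RegularGaugeGroup.measurable_reTr _ _).indicator hSm).comp hΦm)).aestronglyMeasurable
  have hF'm : ∀ μ, AEStronglyMeasurable (F' μ) ν := fun μ =>
    (hjm.mul ((((hAm.const_mul β₀).neg.mul (measurable_boltzmann RegularGaugeGroup.measurable_reTr _ _)).indicator hSm).comp hΦm)).aestronglyMeasurable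
  -- bounds
  have hbz : ∀ {μ : ℝ}, 0 ≤ μ → ∀ U : GaugeField (F.P K) 0 (Matrix.specialUnitaryGroup (Fin 2) ℂ), boltzmann (F.P K) (μ * β₀) U ≤ 1 :=
    fun hμ U => boltzmann_le_one _ (mul_nonneg hμ hβ₀) U
  have hFint : Integrable (Fμ μ₀) ν := by
    refine Integrable.mono' (integrable_const (c.bound : ℝ)) (hFm μ₀) (Eventually.of_forall fun z => ?_)
    simp only [hFμ]
    rw [Real.norm_eq_abs, abs_mul, abs_of_nonneg (c.jac (V, z)).coe_nonneg]
    have h1 : |Sfine.indicator (boltzmann (F.P K) (μ₀ * β₀)) (c.Φ (V, z))| ≤ 1 := by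
      by_cases h : c.Φ (V, z) ∈ Sfine
      · rw [Set.indicator_of_mem h, abs_of_nonneg (boltzmann_pos _ _ _).le]; exact hbz hμ₀.le _
      · rw [Set.indicator_of_notMem h, abs_zero]; exact zero_le_one
    calc (c.jac (V, z) : ℝ) * |Sfine.indicator (boltzmann (F.P K) (μ₀ * β₀)) (c.Φ (V, z))| ≤ (c.jac (V, z) : ℝ) * 1 :=
          mul_le_mul_of_nonneg_left h1 (c.jac (V, z)).coe_nonneg
      _ ≤ (c.bound : ℝ) := by rw [mul_one]; exact_mod_cast c.jac_le (V, z)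
  have hbound : ∀ᵐ z ∂ν, ∀ μ ∈ ball μ₀ (μ₀ / 2), ‖F' μ z‖ ≤ (c.bound : ℝ) * (β₀ * Amax) := by
    refine Eventually.of_forall fun z μ hμ => ?_
    have hμpos : 0 ≤ μ := by
      rw [mem_ball, Real.dist_eq] at hμ
      have := abs_lt.mp hμ; linarith
    simp only [hF']
    rw [Real.norm_eq_abs, abs_mul, abs_of_nonneg (c.jac (V, z)).coe_nonneg]
    have h1 : |Sfine.indicator (fun U' => -(β₀ * wilsonAction4 U') * boltzmann (F.P K) (μ * β₀) U') (c.Φ (V, z))| ≤ β₀ * Amax := by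
      by_cases h : c.Φ (V, z) ∈ Sfine
      · rw [Set.indicator_of_mem h, abs_mul, abs_neg, abs_of_nonneg (mul_nonneg hβ₀ (hA0 _)), abs_of_nonneg (boltzmann_pos _ _ _).le]
        calc β₀ * wilsonAction4 (c.Φ (V, z)) * boltzmann (F.P K) (μ * β₀) (c.Φ (V, z)) ≤ β₀ * Amax * 1 :=
            mul_le_mul (mul_le_mul_of_nonneg_left (hAle _) hβ₀) (hbz hμpos _) (boltzmann_pos _ _ _).le
              (mul_nonneg hβ₀ (by positivity))
          _ = β₀ * Amax := mul_one _
      · rw [Set.indicator_of_notMem h, abs_zero]; positivity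
    have hj : (c.jac (V, z) : ℝ) ≤ (c.bound : ℝ) := by exact_mod_cast c.jac_le (V, z)
    exact mul_le_mul hj h1 (abs_nonneg _) (c.bound).coe_nonneg
  have hdiff : ∀ᵐ z ∂ν, ∀ μ ∈ ball μ₀ (μ₀ / 2), HasDerivAt (fun μ' => Fμ μ' z) (F' μ z) μ := by
    refine Eventually.of_forall fun z μ _ => ?_
    simp only [hFμ, hF']
    exact (hasDerivAt_indicator_boltzmann (Sfine := Sfine) (c.Φ (V, z)) β₀ μ).const_mul _
  have key := hasDerivAt_integral_of_dominated_loc_of_deriv_le (ball_mem_nhds μ₀ (half_pos hμ₀)) (Eventually.of_forall hFm) hFint (hF'm μ₀) hbound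
    (integrable_const _) hdiff
  exact key.2

end FibreInt

/-! ## §3 DIFF -/

/-- ★★★ **DIFF `FluctDifferentiableCan` OF LINE g20-1 — THE λ-SCALED FLUCTUATION PART IS DIFFERENTIABLE IN λ ON THE WINDOW** (the line's text with its
`heightDensityCan`∕`fluctAtCan` unfolded over ✓`…WregGlue.heightDensityCan`; the line closes `stub_fluctDifferentiableCan` by `delta`): for every block size there
are thresholds such that for every family, coupling `γ ≤ γ₁`, run `K`, height `J ≤ K`, window datum `V` and `λ ≥ 1`,
`μ ↦ log heightDensityCan F (γ∕μ) (histGood at θBal(γ)) V + β_K(γ∕μ)·minActionRegPr(V)` is differentiable at `λ`.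
[cite: Balaban1985UV3, (2) p.256 and (41) p.266; Michael1987, (2.3)] -/
theorem fluctDifferentiableCan :
    ∀ (L : ℕ), ∃ pS : ℝ, ∀ (b₀ p₀ : ℝ), 0 < b₀ → pS ≤ p₀ → 0 < p₀ → ∃ ε₁ : ℝ, 0 < ε₁ ∧ ∀ (ε₀ : ℝ), 0 < ε₀ → ε₀ ≤ ε₁ →
      ∃ γ₁ : ℝ, 0 < γ₁ ∧ ∀ (F : T3Family) (γ : ℝ), F.L = L → 0 < γ → γ ≤ γ₁ →
        ∀ (J K : ℕ) (hJK : J ≤ K) (V : GaugeField (F.P J) 0 (Matrix.specialUnitaryGroup (Fin 2) ℂ)), PlaqSmall (θBal F.L γ b₀ p₀ J) V →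
          ∀ lam : ℝ, 1 ≤ lam → DifferentiableAt ℝ (fun μ : ℝ =>
            Real.log (heightDensityCan F (γ / μ) hJK (histGood F ℰp (θBal F.L γ b₀ p₀) K J) V)
              + (F.scheme ℰp (γ / μ)).β K * minActionRegPr F J K hJK ε₀ V) lam := by
  intro L
  refine ⟨0, fun b₀ p₀ hb _ hp => ⟨1, one_pos, fun ε₀ _ _ => ?_⟩⟩
  obtain ⟨γC, hγC, hCF⟩ := windowCharts L b₀ p₀ hb hp
  obtain ⟨γW, hγW, hWF⟩ := windowRegularity L b₀ p₀ hb hp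
  refine ⟨min γC γW, lt_min hγC hγW, fun F γ hL hγ hγle J K hJK V hV lam hlam => ?_⟩
  have hlam0 : 0 < lam := lt_of_lt_of_le one_pos hlam
  have hSm : MeasurableSet (histGood F ℰp (θBal F.L γ b₀ p₀) K J) := measurableSet_histGood F ℰp measurableE_ℰp _ K J
  obtain ⟨O, hO, hVO, ⟨c⟩⟩ := hCF F γ hL hγ (hγle.trans (min_le_left _ _)) J K hJK V hV
  -- the inverse coupling at `γ` and the fibre integral
  set β₀ : ℝ := (γ * (F.P K).eps)⁻¹ with hβ₀
  have hβ₀0 : 0 ≤ β₀ := inv_nonneg.mpr (mul_nonneg hγ.le (F.P K).eps_pos.le)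
  set G : ℝ → ℝ := fun μ => ∫ z, (c.jac (V, z) : ℝ) *
    (histGood F ℰp (θBal F.L γ b₀ p₀) K J).indicator (boltzmann (F.P K) (μ * β₀)) (c.Φ (V, z))
      ∂fieldMeasure (F.P K) 0 (Matrix.specialUnitaryGroup (Fin 2) ℂ) with hG
  -- on `μ > 0` the canonical version IS the fibre integral
  have hEq : ∀ μ : ℝ, 0 < μ → heightDensityCan F (γ / μ) hJK (histGood F ℰp (θBal F.L γ b₀ p₀) K J) V = G μ := by
    intro μ hμ
    rw [heightDensityCan_eq_fibreInt c hO hSm (div_nonneg hγ.le hμ.le) hVO, scheme_β_div_eq_mul_inv]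
  have hEv : (fun μ : ℝ => Real.log (heightDensityCan F (γ / μ) hJK (histGood F ℰp (θBal F.L γ b₀ p₀) K J) V)
      + (F.scheme ℰp (γ / μ)).β K * minActionRegPr F J K hJK ε₀ V) =ᶠ[𝓝 lam]
      fun μ => Real.log (G μ) + μ * β₀ * minActionRegPr F J K hJK ε₀ V := by
    filter_upwards [lt_mem_nhds hlam0] with μ hμ
    rw [hEq μ hμ, scheme_β_div_eq_mul_inv]
  refine (Filter.EventuallyEq.differentiableAt_iff hEv).mpr ?_
  -- positivity at `λ` (WREG (P) at weight coupling `γ∕λ`) and differentiability of the fibre integral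
  have hpos : 0 < G lam := by
    rw [← hEq lam hlam0]
    exact (hWF F γ hL hγ (hγle.trans (min_le_right _ _)) J K hJK (γ / lam) (div_pos hγ hlam0)).2 V hV
  have hGd : DifferentiableAt ℝ G lam := (hasDerivAt_fibreInt c hSm hβ₀0 V hlam0).differentiableAt
  refine (hGd.log hpos.ne').add ?_
  exact ((differentiableAt_id.mul_const β₀).mul_const _)

end Summit.QuantumFields.YangMills.Theorems.FluctuationComparisonRegPrIntLVirialFlowDiff

end
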